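import Literature.AlgebraicGeometry.Resolution.AffineChartFibres
import Literature.AlgebraicGeometry.Resolution.StrictNormalCrossingsPoints
import Literature.AlgebraicGeometry.Resolution.OriginLocalRing
import Literature.AlgebraicGeometry.Resolution.PointBlowupAlgebraCharts
import Mathlib.AlgebraicGeometry.Morphisms.Smooth
import HarnessLib

/-!
# Affine space `𝔸ⁿ⁺¹_K`, the ideal sheaf of its origin, and the chart rings of its blow-up as affine spaces
# (`K[x₀, …, x_n] ≅ K[x][I/xᵢ]`, `xᵢ ↦ xᵢ`, `xⱼ ↦ xⱼ/xᵢ`) — EVERY `n`, EVERY field `K`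

Topic: `Literature/AlgebraicGeometry/Resolution`. Scheme/algebra library file (no named facts), part 1 of the
every-dimension form of `PlanePointBlowupAmbient.lean` (`n = 1`); part 2 is `AffinePointBlowupCharts.lean`. Let `K`
be any field, `P = 𝔸ⁿ⁺¹_K = Spec K[x₀, …, x_n]`, `ξ` its origin (the tree's `originIdeal K (n+1)`), `𝓘 = 𝓘_{ξ}` the
reduced ideal sheaf of the closed point `ξ`, `γ : Γ(P, ⊤) ≅ K[x]`, `coord i = γ⁻¹ xᵢ`.

* `AffinePointBlowup.ideal_𝓘_top` — **`𝓘(⊤) = (x₀, …, x_n)`**; `map_ideal_𝓘_top` — under `γ` this is the ideal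
  `PointBlowup.originIdeal n K` of `PointBlowupAlgebraCharts.lean`; `𝓘_ne_bot`;
* `AffinePointBlowup.substHom n K i : K[x] →ₐ[K] K[x]`, `xᵢ ↦ xᵢ`, `xⱼ ↦ xᵢ·xⱼ` (`j ≠ i`) — the chart substitution;
  `constantCoeff_substHom`, `specMap_substHom_ξ` (it fixes the origin);
* `AffinePointBlowup.chartRingEquiv n K i : K[x] ≃+* K[x][I/xᵢ]` — **the affine blowup algebra `K[x][I/xᵢ]`
  (`PointBlowup.Chart n K i`) is a polynomial ring in `n + 1` variables over `K`**, `xᵢ ↦ xᵢ`, `xⱼ ↦ xⱼ/xᵢ` (the tree's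
  `PointBlowup.polyEquiv : K[xⱼ/xᵢ : j ≠ i][T] ≅ K[x][I/xᵢ]` after the renaming `iterEquiv`), and
  **`chartRingEquiv ∘ substHom = (K[x] → K[x][I/xᵢ])`** (`chartRingEquiv_substHom`, `chartRingEquiv_symm_algebraMap`):
  in the coordinates `y = chartRingEquiv⁻¹` of the chart, the structure map of the blow-up is `xᵢ ↦ yᵢ`, `xⱼ ↦ yᵢ·yⱼ`;
* `AffinePointBlowup.specMap_comp_γ_fromSpec` — bookkeeping `Spec (φ ∘ γ) ≫ (Spec Γ(P, ⊤) → P) = Spec φ`.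

These are the standard charts `Bl_0 𝔸ⁿ⁺¹ = ⋃ᵢ Spec K[xᵢ, xⱼ/xᵢ]` (Hartshorne I §4 p. 29 / II Ex. 7.12; Eisenbud–Harris
§9.3.2; Görtz–Wedhorn I Example 13.95) at ring level, every `n` and every `K`.

## Sources

* The Stacks Project, Tag 0804 (the blowing up is covered by the `Spec A[I/a]`), Tag 0BIQ, Tag 01HR. [StacksProject]
* D. Eisenbud, J. Harris, *3264 and All That* (2016), §9.3.2. [EisenbudHarris2016]
* A. Grothendieck, EGA IV₄ (1967), Prop. 17.5.8 (iii) (polynomial algebras are smooth). [Grothendieck1967]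
-/

noncomputable section

open CategoryTheory AlgebraicGeometry TopologicalSpace Opposite MvPolynomial
open Scheme.IdealSheafData

namespace Literature.AlgebraicGeometry.Resolution

namespace AffinePointBlowup

universe u

variable (n : ℕ) (K : Type u) [Field K]

/-! ## Affine space, its structure map, the origin and its ideal sheaf -/

/-- The coordinate ring `K[x₀, …, x_n]`. [folklore] -/
abbrev A : Type u := MvPolynomial (Fin (n + 1)) K

/-- Affine space `P = 𝔸ⁿ⁺¹_K = Spec K[x₀, …, x_n]`. [folklore] -/
abbrev P : Scheme.{u} := Spec (.of (A n K))

/-- The structure morphism `P → Spec K`. [folklore] -/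
def f : P n K ⟶ Spec (.of K) := Spec.map (CommRingCat.ofHom (algebraMap K (A n K)))

/-- `K[x₀, …, x_n]` is a smooth `K`-algebra. [folklore] -/
instance smooth_A : Algebra.Smooth K (A n K) := {}

/-- `𝔸ⁿ⁺¹_K → Spec K` is smooth (every field). [cite: Grothendieck1967, Prop. 17.5.8 (iii) (PDF p. 69)] -/
theorem smooth_f : Smooth (f n K) := by
  rw [f, HasRingHomProperty.Spec_iff (P := @Smooth), CommRingCat.hom_ofHom, RingHom.smooth_algebraMap]
  infer_instance

/-- `𝔸ⁿ⁺¹_K → Spec K` is quasi-compact. [cite: StacksProject, Tag 01K4] -/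
instance quasiCompact_f : QuasiCompact (f n K) := by rw [f]; infer_instance

/-- The origin `ξ = (x₀, …, x_n)` (the tree's `originIdeal K (n+1)`). [folklore] -/
def ξ : P n K := ⟨originIdeal K (n + 1), inferInstance⟩

/-- The origin is a closed point. [cite: StacksProject, Tag 01HR] -/
theorem isClosed_ξ : IsClosed ({ξ n K} : Set (P n K)) :=
  (PrimeSpectrum.isClosed_singleton_iff_isMaximal _).mpr (originIdeal.isMaximal (F := K) (n := n + 1))

/-- The origin as a closed subset. [folklore] -/
def C₀ : Closeds (P n K) := ⟨{ξ n K}, isClosed_ξ n K⟩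

/-- The reduced ideal sheaf `𝓘 = 𝓘_{ξ}` of the origin. [folklore] -/
def 𝓘 : (P n K).IdealSheafData := vanishingIdeal (C₀ n K)

/-- The affine open `⊤ ⊆ P`. [folklore] -/
abbrev Wtop : (P n K).affineOpens := ⟨⊤, isAffineOpen_top _⟩

/-- `Γ(P, ⊤) ≅ K[x₀, …, x_n]`. [folklore] -/
def γ : Γ(P n K, Wtop n K) ≃+* A n K := (Scheme.ΓSpecIso (.of (A n K))).commRingCatIsoToRingEquiv

/-- `γ⁻¹ a = ΓSpecIso⁻¹ a`. [cite: StacksProject, Tag 01HR] -/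
theorem γ_symm_apply (a : A n K) : (γ n K).symm a = (Scheme.ΓSpecIso (.of (A n K))).inv.hom a := rfl

/-- `γ (ΓSpecIso⁻¹ a) = a`. [cite: StacksProject, Tag 01HR] -/
theorem γ_ΓSpecIso_inv (a : A n K) : γ n K ((Scheme.ΓSpecIso (.of (A n K))).inv.hom a) = a :=
  (γ n K).apply_symm_apply a

/-- `Γ(P, ⊤)` is a domain. [cite: StacksProject, Tag 01HR] -/
instance isDomain_Γ : IsDomain Γ(P n K, Wtop n K) := MulEquiv.isDomain (A n K) (γ n K).toMulEquiv

/-- The coordinate functions `xᵢ ∈ Γ(P, ⊤)`. [folklore] -/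
def coord (i : Fin (n + 1)) : Γ(P n K, Wtop n K) := (γ n K).symm (X i)

/-- `γ xᵢ = Xᵢ`. [cite: StacksProject, Tag 01HR] -/
@[simp] theorem γ_coord (i : Fin (n + 1)) : γ n K (coord n K i) = X i := (γ n K).apply_symm_apply _

/-- The point of `Spec Γ(P, ⊤)` corresponding to the origin: `γ⁻¹(x₀, …, x_n)`. [folklore] -/
def ξt : PrimeSpectrum Γ(P n K, Wtop n K) :=
  ⟨(originIdeal K (n + 1)).comap (γ n K : Γ(P n K, Wtop n K) →+* A n K), Ideal.comap_isPrime _ _⟩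

/-- `γ⁻¹(x₀, …, x_n) = (coord 0, …, coord n)`. [cite: StacksProject, Tag 01HR] -/
theorem ξt_asIdeal : (ξt n K).asIdeal = Ideal.span (Set.range (coord n K)) := by
  change (originIdeal K (n + 1)).comap (γ n K : Γ(P n K, Wtop n K) →+* A n K) = _
  have h : (originIdeal K (n + 1)).comap (γ n K : Γ(P n K, Wtop n K) →+* A n K) =
      (originIdeal K (n + 1)).map ((γ n K).symm : A n K →+* Γ(P n K, Wtop n K)) :=
    (Ideal.map_symm (γ n K)).symm
  rw [h, originIdeal_eq_span, Ideal.map_span]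
  congr 1
  ext s
  simp only [Set.mem_image, Set.mem_range, RingEquiv.coe_toRingHom]
  constructor
  · rintro ⟨a, ⟨i, rfl⟩, rfl⟩
    exact ⟨i, rfl⟩
  · rintro ⟨i, rfl⟩
    exact ⟨X i, ⟨i, rfl⟩, rfl⟩

/-- `Spec Γ(P, ⊤) → P` is `Spec` of `ΓSpecIso⁻¹`. [cite: StacksProject, Tag 01HR] -/
theorem fromSpec_Wtop : (Wtop n K).2.fromSpec = Spec.map (Scheme.ΓSpecIso (.of (A n K))).inv := by
  change (isAffineOpen_top (P n K)).fromSpec = _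
  rw [IsAffineOpen.fromSpec_top, Scheme.isoSpec_Spec_inv]

/-- The point `ξt` of `Spec Γ(P, ⊤)` maps to the origin. [cite: StacksProject, Tag 01HR] -/
theorem fromSpec_Wtop_ξt : (Wtop n K).2.fromSpec (ξt n K) = ξ n K := by
  rw [fromSpec_Wtop]
  apply PrimeSpectrum.ext
  ext a
  change γ n K ((Scheme.ΓSpecIso (.of (A n K))).inv.hom a) ∈ originIdeal K (n + 1) ↔ a ∈ originIdeal K (n + 1)
  rw [γ_ΓSpecIso_inv]

/-- The prime of the origin in `Γ(P, ⊤)` is `ξt`. [cite: StacksProject, Tag 01HR] -/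
theorem primeIdealOf_ξ : (Wtop n K).2.primeIdealOf ⟨ξ n K, trivial⟩ = ξt n K := by
  have h2 := primeIdealOf_fromSpec (Wtop n K).2 (ξt n K)
  rw [← h2]
  congr 1
  exact Subtype.ext (fromSpec_Wtop_ξt n K).symm

/-- **`𝓘_{ξ}(⊤) = (x₀, …, x_n)`.** [cite: StacksProject, Tag 01HR] -/
theorem ideal_𝓘_top : (𝓘 n K).ideal (Wtop n K) = Ideal.span (Set.range (coord n K)) := by
  have hUZ : ((Wtop n K : (P n K).Opens) : Set (P n K)) ∩ {ξ n K} = {ξ n K} := by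
    change (Set.univ : Set (P n K)) ∩ {ξ n K} = {ξ n K}
    exact Set.univ_inter _
  have h := vanishingIdeal_ideal_eq_primeIdealOf (isClosed_ξ n K) (Wtop n K) trivial hUZ
  change (vanishingIdeal ⟨{ξ n K}, isClosed_ξ n K⟩).ideal (Wtop n K) = _
  rw [h, primeIdealOf_ξ, ξt_asIdeal]

/-- Under `γ`, `𝓘_{ξ}(⊤)` is the ideal `(X₀, …, X_n)` of `PointBlowupAlgebraCharts.lean`. [cite: StacksProject, Tag 01HR] -/
theorem map_ideal_𝓘_top :
    ((𝓘 n K).ideal (Wtop n K)).map (γ n K).toRingHom = PointBlowup.originIdeal n K := by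
  rw [ideal_𝓘_top, Ideal.map_span]
  change Ideal.span _ = Ideal.span (Set.range X)
  congr 1
  ext a
  simp only [Set.mem_image, Set.mem_range, RingEquiv.toRingHom_eq_coe, RingEquiv.coe_toRingHom]
  constructor
  · rintro ⟨s, ⟨i, rfl⟩, rfl⟩
    exact ⟨i, (γ_coord n K i).symm⟩
  · rintro ⟨i, rfl⟩
    exact ⟨coord n K i, ⟨i, rfl⟩, γ_coord n K i⟩

/-- `xᵢ ∈ 𝓘_{ξ}(⊤)`. [cite: StacksProject, Tag 01HR] -/
theorem coord_mem (i : Fin (n + 1)) : coord n K i ∈ (𝓘 n K).ideal (Wtop n K) := by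
  rw [ideal_𝓘_top]
  exact Ideal.subset_span ⟨i, rfl⟩

/-- `xᵢ ≠ 0` in `Γ(P, ⊤)`. [cite: StacksProject, Tag 01HR] -/
theorem coord_ne_zero (i : Fin (n + 1)) : coord n K i ≠ 0 := by
  intro h0
  have := congrArg (γ n K) h0
  rw [γ_coord, map_zero] at this
  exact X_ne_zero i this

/-- `𝓘_{ξ} ≠ 0`. [cite: StacksProject, Tag 01HR] -/
theorem 𝓘_ne_bot : 𝓘 n K ≠ ⊥ := by
  intro h
  have h1 : coord n K 0 ∈ (𝓘 n K).ideal (Wtop n K) := coord_mem n K 0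
  rw [h, Scheme.IdealSheafData.ideal_bot] at h1
  exact coord_ne_zero n K 0 h1

/-! ## The chart substitution `xᵢ ↦ xᵢ`, `xⱼ ↦ xᵢ·xⱼ` and the chart ring `K[x] ≅ K[x][I/xᵢ]` -/

section Algebra

variable (i : Fin (n + 1))

/-- **The chart substitution** `substHom i : K[x] → K[x]`, `xᵢ ↦ xᵢ`, `xⱼ ↦ xᵢ·xⱼ` (`j ≠ i`) — the ring map of the
`i`-th chart `𝔸ⁿ⁺¹ → 𝔸ⁿ⁺¹` of the blow-up of the origin. [cite: EisenbudHarris2016, §9.3.2] -/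
def substHom : A n K →ₐ[K] A n K := aeval fun j => if j = i then X i else X i * X j

/-- `substHom i (xᵢ) = xᵢ`. [cite: EisenbudHarris2016, §9.3.2] -/
@[simp] theorem substHom_X_self : substHom n K i (X i) = X i := by
  simp [substHom]

/-- `substHom i (xⱼ) = xᵢ·xⱼ` for `j ≠ i`. [cite: EisenbudHarris2016, §9.3.2] -/
theorem substHom_X_of_ne {j : Fin (n + 1)} (h : j ≠ i) : substHom n K i (X j) = X i * X j := by
  simp [substHom, h]

/-- `substHom i` on constants. [cite: EisenbudHarris2016, §9.3.2] -/
@[simp] theorem substHom_C (c : K) : substHom n K i (C c) = C c :=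
  MvPolynomial.algHom_C _ c

/-- `substHom i` preserves the constant coefficient (it fixes the origin). [cite: EisenbudHarris2016, §9.3.2] -/
theorem constantCoeff_substHom (a : A n K) : constantCoeff (substHom n K i a) = constantCoeff a := by
  induction a using MvPolynomial.induction_on with
  | C c => rw [substHom_C]
  | add p q hp hq => simp only [map_add, hp, hq]
  | mul_X p j hp =>
    by_cases h : j = i
    · subst h
      simp [hp]
    · simp [hp, substHom_X_of_ne n K i h]

/-- `substHom i` fixes the origin: `Spec (substHom i) (ξ) = ξ`. [cite: EisenbudHarris2016, §9.3.2] -/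
theorem specMap_substHom_ξ :
    Spec.map (CommRingCat.ofHom (substHom n K i).toRingHom) (ξ n K) = ξ n K := by
  apply PrimeSpectrum.ext
  ext a
  change substHom n K i a ∈ originIdeal K (n + 1) ↔ a ∈ originIdeal K (n + 1)
  rw [mem_originIdeal_iff, mem_originIdeal_iff, constantCoeff_substHom]

/-- The reindexing `K[x₀, …, x_n] → K[xⱼ/xᵢ : j ≠ i][T]`, `xᵢ ↦ T`, `xⱼ ↦ (xⱼ/xᵢ)` (a mere renaming of variables).
[cite: EisenbudHarris2016, §9.3.2] -/
def toIter : A n K →ₐ[K] MvPolynomial Unit (PointBlowup.Base n K i) :=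
  aeval fun j => if h : j = i then X () else C (X ⟨j, h⟩)

/-- `toIter (xᵢ) = T`. [cite: EisenbudHarris2016, §9.3.2] -/
@[simp] theorem toIter_X_self : toIter n K i (X i) = X () := by
  simp [toIter]

/-- `toIter (xⱼ) = xⱼ/xᵢ` (as a constant of `K[xⱼ/xᵢ][T]`) for `j ≠ i`. [cite: EisenbudHarris2016, §9.3.2] -/
theorem toIter_X_of_ne {j : Fin (n + 1)} (h : j ≠ i) : toIter n K i (X j) = C (X ⟨j, h⟩) := by
  simp [toIter, h]

/-- `toIter` on constants. [cite: EisenbudHarris2016, §9.3.2] -/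
@[simp] theorem toIter_C (c : K) : toIter n K i (C c) = C (C c) := by
  rw [toIter, MvPolynomial.algHom_C,
    IsScalarTower.algebraMap_apply K (PointBlowup.Base n K i) (MvPolynomial Unit (PointBlowup.Base n K i)),
    MvPolynomial.algebraMap_eq, MvPolynomial.algebraMap_eq]

/-- The inverse renaming `K[xⱼ/xᵢ : j ≠ i][T] → K[x₀, …, x_n]`, `T ↦ xᵢ`, `xⱼ/xᵢ ↦ xⱼ`. [cite: EisenbudHarris2016, §9.3.2] -/
def ofIter : MvPolynomial Unit (PointBlowup.Base n K i) →+* A n K :=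
  eval₂Hom (rename (Subtype.val : {j : Fin (n + 1) // j ≠ i} → Fin (n + 1))).toRingHom fun _ => X i

/-- `ofIter` on constants: the renaming `xⱼ/xᵢ ↦ xⱼ`. [cite: EisenbudHarris2016, §9.3.2] -/
@[simp] theorem ofIter_C (b : PointBlowup.Base n K i) :
    ofIter n K i (C b) = rename (Subtype.val : {j : Fin (n + 1) // j ≠ i} → Fin (n + 1)) b :=
  eval₂Hom_C _ _ b

/-- `ofIter (T) = xᵢ`. [cite: EisenbudHarris2016, §9.3.2] -/
@[simp] theorem ofIter_X (u : Unit) : ofIter n K i (X u) = X i :=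
  eval₂Hom_X' _ _ u

/-- `ofIter ∘ toIter = id`. [cite: EisenbudHarris2016, §9.3.2] -/
theorem ofIter_comp_toIter : (ofIter n K i).comp (toIter n K i).toRingHom = RingHom.id _ := by
  apply MvPolynomial.ringHom_ext
  · intro c
    simp
  · intro j
    by_cases h : j = i
    · subst h
      simp
    · simp [toIter_X_of_ne n K i h, rename_X]

/-- `toIter ∘ (xⱼ/xᵢ ↦ xⱼ) = C` on `K[xⱼ/xᵢ : j ≠ i]`. [cite: EisenbudHarris2016, §9.3.2] -/
theorem toIter_comp_rename :
    (toIter n K i).toRingHom.comp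
        (rename (Subtype.val : {j : Fin (n + 1) // j ≠ i} → Fin (n + 1))).toRingHom =
      (C : PointBlowup.Base n K i →+* MvPolynomial Unit (PointBlowup.Base n K i)) := by
  apply MvPolynomial.ringHom_ext
  · intro c
    simp
  · rintro ⟨j, h⟩
    simp [rename_X, toIter_X_of_ne n K i h]

/-- `toIter ∘ ofIter = id`. [cite: EisenbudHarris2016, §9.3.2] -/
theorem toIter_comp_ofIter : (toIter n K i).toRingHom.comp (ofIter n K i) = RingHom.id _ := by
  apply MvPolynomial.ringHom_ext
  · intro b
    have h := RingHom.congr_fun (toIter_comp_rename n K i) b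
    simp only [RingHom.comp_apply] at h
    simp only [RingHom.comp_apply, ofIter_C, RingHom.id_apply]
    exact h
  · rintro ⟨⟩
    simp

/-- The renaming isomorphism `K[x₀, …, x_n] ≅ K[xⱼ/xᵢ : j ≠ i][T]`. [cite: EisenbudHarris2016, §9.3.2] -/
def iterEquiv : A n K ≃+* MvPolynomial Unit (PointBlowup.Base n K i) :=
  RingEquiv.ofRingHom (toIter n K i).toRingHom (ofIter n K i) (toIter_comp_ofIter n K i)
    (ofIter_comp_toIter n K i)

/-- `iterEquiv a = toIter a`. [cite: EisenbudHarris2016, §9.3.2] -/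
@[simp] theorem iterEquiv_apply (a : A n K) : iterEquiv n K i a = toIter n K i a := rfl

/-- **The chart ring is an affine space**: `chartRingEquiv i : K[x₀, …, x_n] ≅ K[x][I/xᵢ]`, `xᵢ ↦ xᵢ`,
`xⱼ ↦ xⱼ/xᵢ` (the tree's `PointBlowup.polyEquiv` after renaming the variables). [cite: EisenbudHarris2016, §9.3.2] -/
def chartRingEquiv : A n K ≃+* PointBlowup.Chart n K i :=
  (iterEquiv n K i).trans (PointBlowup.polyEquiv n K i)

/-- `chartRingEquiv a = polyEquiv (toIter a)`. [cite: EisenbudHarris2016, §9.3.2] -/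
theorem chartRingEquiv_apply (a : A n K) :
    chartRingEquiv n K i a = PointBlowup.polyHom n K i (toIter n K i a) := rfl

/-- `chartRingEquiv i (xᵢ) = xᵢ` (the exceptional equation `exc`). [cite: EisenbudHarris2016, §9.3.2] -/
@[simp] theorem chartRingEquiv_X_self : chartRingEquiv n K i (X i) = PointBlowup.exc n K i := by
  rw [chartRingEquiv_apply, toIter_X_self, PointBlowup.polyHom_X]

/-- `chartRingEquiv i (xⱼ) = xⱼ/xᵢ` for `j ≠ i`. [cite: EisenbudHarris2016, §9.3.2] -/
theorem chartRingEquiv_X_of_ne {j : Fin (n + 1)} (h : j ≠ i) :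
    chartRingEquiv n K i (X j) = PointBlowup.frac n K i j := by
  rw [chartRingEquiv_apply, toIter_X_of_ne n K i h, PointBlowup.polyHom_C, PointBlowup.baseHom_X]

/-- `chartRingEquiv i` on constants. [cite: EisenbudHarris2016, §9.3.2] -/
@[simp] theorem chartRingEquiv_C (c : K) :
    chartRingEquiv n K i (C c) = algebraMap K (PointBlowup.Chart n K i) c := by
  rw [chartRingEquiv_apply, toIter_C, PointBlowup.polyHom_C, PointBlowup.baseHom_C]

/-- **`chartRingEquiv i ∘ substHom i` is the structure map `K[x] → K[x][I/xᵢ]`**: `xⱼ = xᵢ · (xⱼ/xᵢ)`.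
[cite: StacksProject, Tag 0BIQ] -/
theorem chartRingEquiv_substHom (a : A n K) :
    chartRingEquiv n K i (substHom n K i a) = algebraMap (A n K) (PointBlowup.Chart n K i) a := by
  induction a using MvPolynomial.induction_on with
  | C c =>
    rw [substHom_C, chartRingEquiv_C, IsScalarTower.algebraMap_apply K (A n K) (PointBlowup.Chart n K i) c,
      MvPolynomial.algebraMap_eq]
  | add p q hp hq => rw [map_add, map_add, map_add, hp, hq]
  | mul_X p j hp =>
    have hj : chartRingEquiv n K i (substHom n K i (X j)) = PointBlowup.exc n K i * PointBlowup.frac n K i j := by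
      by_cases h : j = i
      · subst h
        rw [substHom_X_self, chartRingEquiv_X_self, PointBlowup.frac_self, mul_one]
      · rw [substHom_X_of_ne n K i h, map_mul, chartRingEquiv_X_self, chartRingEquiv_X_of_ne n K i h]
    rw [map_mul, map_mul, map_mul, hp, hj, PointBlowup.algebraMap_X]

/-- The inverse form: `chartRingEquiv⁻¹ (a/1) = substHom i a`. [cite: StacksProject, Tag 0BIQ] -/
theorem chartRingEquiv_symm_algebraMap (a : A n K) :
    (chartRingEquiv n K i).symm (algebraMap (A n K) (PointBlowup.Chart n K i) a) = substHom n K i a := by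
  rw [RingEquiv.symm_apply_eq, chartRingEquiv_substHom]

/-- `Spec K[x] → P` through `γ`: for a ring map `φ : K[x] → S`, `Spec (φ ∘ γ) ≫ (Spec Γ(P, ⊤) → P) = Spec φ`.
[cite: StacksProject, Tag 01HR] -/
theorem specMap_comp_γ_fromSpec {S : Type u} [CommRing S] (φ : A n K →+* S) :
    Spec.map (CommRingCat.ofHom (φ.comp (γ n K).toRingHom)) ≫ (Wtop n K).2.fromSpec =
      Spec.map (CommRingCat.ofHom φ) := by
  have e1 : CommRingCat.ofHom (φ.comp (γ n K).toRingHom) =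
      (Scheme.ΓSpecIso (.of (A n K))).hom ≫ CommRingCat.ofHom φ := by
    apply CommRingCat.hom_ext
    exact RingHom.ext fun a => rfl
  have e2 : Spec.map (CommRingCat.ofHom (φ.comp (γ n K).toRingHom)) =
      Spec.map (CommRingCat.ofHom φ) ≫ Spec.map (Scheme.ΓSpecIso (.of (A n K))).hom := by
    rw [← Spec.map_comp, ← e1]
  rw [fromSpec_Wtop, e2, Category.assoc, ← Spec.map_comp, Iso.inv_hom_id, Spec.map_id, Category.comp_id]

end Algebra

end AffinePointBlowup

end Literature.AlgebraicGeometry.Resolution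

end
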